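import Literature.Geometry.Lorentzian.TracedGaussEquation
import Literature.Geometry.Lorentzian.GerochMonotonicityVariation
import HarnessLib

/-!
# Geroch monotonicity: the Gauss equation input (F2) is a theorem

`geroch_monotonicity_smooth_of_F123` (`GerochMonotonicityIntegrability.lean`) reduces the named
fact `geroch_monotonicity_smooth` (Huisken–Ilmanen 2001, §5, Monotonicity Calculation, smooth
case) to three classical inputs at each time of each classical solution: (F1) the derivative of
`∫ H²` with the evolution equation (1.3), (F2) the traced Gauss equation
`R(g_t) = R(h) ∘ F_t − 2Rc_h(ν,ν) + H² − |A|²` ("since `N_t` is a surface, `2K = R − 2Rc(ν,ν)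
+ H² − |A|²` by the Gauss equation"), and (F3) the Gauss–Bonnet bound. This file discharges (F2):

* `IsClassicalIMCF.gauss_equation` — for a classical solution of inverse mean curvature flow by a
  compact surface `S` in a Riemannian `3`-manifold `(X, h)` and `t ∈ (a, b)`, the scalar curvature
  of the induced metric `g_t = F_t^* h` is `R(h) ∘ F_t − 2Rc_h(ν_t, ν_t) + H² − |A|²_{g_t}` at
  every point (`PseudoRiemannianMetric.scalarCurvature_inducedMetric_eq`, the traced Gauss
  equation of an immersed surface in a three-manifold, `TracedGaussEquation.lean`, with `ε = 1`);
* `geroch_monotonicity_smooth_of_F13` — **the fact follows from (F1) and (F3) alone**;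
* `geroch_monotonicity_smooth_of_evolution` — the fact from the evolution equation (1.3) for a
  jointly `C¹` mean curvature and Gauss–Bonnet alone ((F1) by
  `IsClassicalIMCF.hasDerivAt_sqMeanCurvatureIntegral`, `GerochMonotonicityVariation.lean`).

## References

* G. Huisken, T. Ilmanen, *The inverse mean curvature flow and the Riemannian Penrose
  inequality*, J. Differential Geom. 59 (2001) 353–437: §5, Monotonicity Calculation; §1, (1.3).
* B. O'Neill, *Semi-Riemannian geometry*, Academic Press 1983, Ch. 4, Thm. 5 (Gauss equation).
-/

noncomputable section

open Bundle Set Manifold TopologicalSpace Filter MeasureTheory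
open scoped ContDiff Topology ENNReal Manifold Real

namespace Literature.Geometry.Lorentzian

open PseudoRiemannianMetric

variable {X : Type} [TopologicalSpace X] [ChartedSpace E3 X] [IsManifold (𝓡 3) ∞ X]
  {h : ContMDiffRiemannianMetric (𝓡 3) ∞ E3 (TangentSpace (𝓡 3) : X → Type _)}
  [(ofRiemannian h).HasLeviCivita]
  {S : Type} [TopologicalSpace S] [ChartedSpace (EuclideanSpace ℝ (Fin 2)) S]
  [IsManifold (𝓡 2) ∞ S] {hpb : contMDiff_pullbackBilin (𝓡 3) X (𝓡 2) S ∞}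
  {F : ℝ → S → X} {ν : (t : ℝ) → NormalField (𝓡 3) (F t)} {a b : ℝ}

/-- **The Gauss equation input (F2) of the Monotonicity Calculation holds for every classical
solution**: for a classical solution of inverse mean curvature flow by a surface `S` in the
Riemannian `3`-manifold `(X, h)`, `t ∈ (a, b)` and `y ∈ S`,
`R(g_t)(y) = R(h)(F_t y) − 2 Rc_h(ν_t y, ν_t y) + H_t(y)² − |A_t|²_{g_t}(y)` (Huisken–Ilmanen 2001,
§5: "since `N_t` is a surface, by the Gauss equation"; the traced Gauss equation
`scalarCurvature_inducedMetric_eq` for the spacelike immersion `F_t` with its unit normal `ν_t`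
of sign `ε = 1`, `dim S = 2`, `dim X = 3`).
[cite: HuiskenIlmanenIMCF2001, §5 Monotonicity Calculation (Gauss equation)] -/
theorem IsClassicalIMCF.gauss_equation (Hc : IsClassicalIMCF h hpb F ν a b) {t : ℝ}
    (ht : t ∈ Set.Ioo a b) (y : S) :
    haveI := ((ofRiemannian h).inducedMetric (F t) hpb (Hc.isSpacelikeImmersion t ht)).hasLeviCivita
    ((ofRiemannian h).inducedMetric (F t) hpb (Hc.isSpacelikeImmersion t ht)).scalarCurvature y =
      (ofRiemannian h).scalarCurvature (F t y) -
        2 * (ofRiemannian h).ricci (F t y) (ν t y) (ν t y) +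
        (ofRiemannian h).meanCurvature (F t) hpb (Hc.isSpacelikeImmersion t ht) (ν t) y ^ 2 -
        ((ofRiemannian h).inducedMetric (F t) hpb (Hc.isSpacelikeImmersion t ht)).normSq y
          ((ofRiemannian h).secondFundamentalForm (𝓡 2) (F t) (ν t) y) := by
  have key := (ofRiemannian h).scalarCurvature_inducedMetric_eq hpb (Hc.isSpacelikeImmersion t ht)
    (Hc.contMDiff_normal t ht) (Hc.isUnitNormal t ht) one_ne_zero finrank_euclideanSpace_fin
    finrank_euclideanSpace_fin y
  simp only [div_one] at key
  rw [key]
  ring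

/-- **`geroch_monotonicity_smooth` from (F1) and (F3).** The named fact (Huisken–Ilmanen 2001,
§5, Monotonicity Calculation, smooth case) follows from the two remaining classical inputs at
each time of each classical solution with `R ≥ 0`: (F1) the derivative
`d/dt ∫ H² = ∫ (2H ∂_tH + H²) dμ_t` with the evolution equation (1.3) for `∂_t H` (first
variation of area (1.1) and differentiation under the integral sign), and (F3) the Gauss–Bonnet
bound `∫ R(g_t) dμ_t ≤ 8π` (`∫ K = 2πχ(N_t) ≤ 4π` for connected `N_t`) —
`geroch_monotonicity_smooth_of_F123` with (F2) discharged by `IsClassicalIMCF.gauss_equation`.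
[cite: HuiskenIlmanenIMCF2001, §5 Monotonicity Calculation (smooth case)] -/
theorem geroch_monotonicity_smooth_of_F13
    (hin : ∀ (X : Type) [TopologicalSpace X] [ChartedSpace E3 X] [IsManifold (𝓡 3) ∞ X]
      [T2Space X] [SecondCountableTopology X]
      (h : ContMDiffRiemannianMetric (𝓡 3) ∞ E3 (TangentSpace (𝓡 3) : X → Type _))
      [(ofRiemannian h).HasLeviCivita]
      (S : Type) [TopologicalSpace S] [ChartedSpace (EuclideanSpace ℝ (Fin 2)) S]
      [IsManifold (𝓡 2) ∞ S] [CompactSpace S] [T2Space S] [ConnectedSpace S]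
      [MeasurableSpace S] [BorelSpace S]
      (hpb : contMDiff_pullbackBilin (𝓡 3) X (𝓡 2) S ∞)
      (F : ℝ → S → X) (ν : (t : ℝ) → NormalField (𝓡 3) (F t)) (a b : ℝ)
      (Hc : IsClassicalIMCF h hpb F ν a b),
      (∀ x : X, 0 ≤ (ofRiemannian h).scalarCurvature x) →
      ∀ t (ht : t ∈ Set.Ioo a b),
      haveI := ((ofRiemannian h).inducedMetric (F t) hpb
        (Hc.isSpacelikeImmersion t ht)).hasLeviCivita
      ∃ dH : S → ℝ,
        HasDerivAt Hc.sqMeanCurvatureIntegral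
          (∫ y, (2 * (ofRiemannian h).meanCurvature (F t) hpb (Hc.isSpacelikeImmersion t ht) (ν t)
              y * dH y +
            (ofRiemannian h).meanCurvature (F t) hpb (Hc.isSpacelikeImmersion t ht) (ν t) y ^ 2)
            ∂(riemannianVolume ((ofRiemannian h).inducedRiemannianMetric (F t) hpb
              (Hc.isSpacelikeImmersion t ht)) 2)) t ∧
        (∀ y, dH y =
          -((ofRiemannian h).inducedMetric (F t) hpb (Hc.isSpacelikeImmersion t ht)).dalembertian
              (fun z ↦ ((ofRiemannian h).meanCurvature (F t) hpb (Hc.isSpacelikeImmersion t ht)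
                (ν t) z)⁻¹) y -
            (((ofRiemannian h).inducedMetric (F t) hpb (Hc.isSpacelikeImmersion t ht)).normSq y
                ((ofRiemannian h).secondFundamentalForm (𝓡 2) (F t) (ν t) y) +
              (ofRiemannian h).ricci (F t y) (ν t y) (ν t y)) /
            (ofRiemannian h).meanCurvature (F t) hpb (Hc.isSpacelikeImmersion t ht) (ν t) y) ∧
        (∫ y, ((ofRiemannian h).inducedMetric (F t) hpb
            (Hc.isSpacelikeImmersion t ht)).scalarCurvature y
          ∂(riemannianVolume ((ofRiemannian h).inducedRiemannianMetric (F t) hpb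
            (Hc.isSpacelikeImmersion t ht)) 2) ≤ 8 * π)) :
    geroch_monotonicity_smooth := by
  refine geroch_monotonicity_smooth_of_F123 ?_
  intro X _ _ _ _ _ h _ S _ _ _ _ _ _ _ _ hpb F ν a b Hc hR t ht
  obtain ⟨dH, hD, hevol, hGB⟩ := hin X h S hpb F ν a b Hc hR t ht
  exact ⟨dH, hD, hevol, fun y ↦ Hc.gauss_equation ht y, hGB⟩

/-- **`geroch_monotonicity_smooth` from the evolution equation (1.3) and Gauss–Bonnet.** The
named fact follows once, for every classical solution with `R ≥ 0`, the mean curvature admits a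
jointly `C¹` representative `Hf` (in the charts of `S`, on `(a, b) × S`) satisfying
Huisken–Ilmanen's evolution equation (1.3), `∂_t H = −Δ(H⁻¹) − (|A|² + Rc(ν,ν))/H`, and the
Gauss–Bonnet bound `∫_{N_t} R(g_t) dμ_t ≤ 8π` holds at every time: (F1) is then
`IsClassicalIMCF.hasDerivAt_sqMeanCurvatureIntegral` (`GerochMonotonicityVariation.lean`), (F2)
is `IsClassicalIMCF.gauss_equation`, and `geroch_monotonicity_smooth_of_F13` applies. What is left
of the smooth Monotonicity Calculation is thus exactly: the joint regularity of `H` with the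
evolution equation (1.3) (HI §1), and Gauss–Bonnet with `χ(N_t) ≤ 2`.
[cite: HuiskenIlmanenIMCF2001, §5 Monotonicity Calculation (smooth case)] -/
theorem geroch_monotonicity_smooth_of_evolution
    (hin : ∀ (X : Type) [TopologicalSpace X] [ChartedSpace E3 X] [IsManifold (𝓡 3) ∞ X]
      [T2Space X] [SecondCountableTopology X]
      (h : ContMDiffRiemannianMetric (𝓡 3) ∞ E3 (TangentSpace (𝓡 3) : X → Type _))
      [(ofRiemannian h).HasLeviCivita]
      (S : Type) [TopologicalSpace S] [ChartedSpace (EuclideanSpace ℝ (Fin 2)) S]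
      [IsManifold (𝓡 2) ∞ S] [CompactSpace S] [T2Space S] [ConnectedSpace S]
      [MeasurableSpace S] [BorelSpace S]
      (hpb : contMDiff_pullbackBilin (𝓡 3) X (𝓡 2) S ∞)
      (F : ℝ → S → X) (ν : (t : ℝ) → NormalField (𝓡 3) (F t)) (a b : ℝ)
      (Hc : IsClassicalIMCF h hpb F ν a b),
      (∀ x : X, 0 ≤ (ofRiemannian h).scalarCurvature x) →
      ∃ Hf : ℝ → S → ℝ,
        -- `Hf` is the mean curvature …
        (∀ t (ht : t ∈ Set.Ioo a b) (y : S), Hf t y =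
          (ofRiemannian h).meanCurvature (F t) hpb (Hc.isSpacelikeImmersion t ht) (ν t) y) ∧
        -- … jointly `C¹` in the charts of `S` …
        (∀ y₀ : S, ContDiffOn ℝ 1 (fun q : ℝ × EuclideanSpace ℝ (Fin 2) ↦
          Hf q.1 ((extChartAt (𝓡 2) y₀).symm q.2))
          (Set.Ioo a b ×ˢ (extChartAt (𝓡 2) y₀).target)) ∧
        -- … and satisfies the evolution equation (1.3)
        (∀ t (ht : t ∈ Set.Ioo a b) (y : S),
          haveI := ((ofRiemannian h).inducedMetric (F t) hpb
            (Hc.isSpacelikeImmersion t ht)).hasLeviCivita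
          deriv (fun t' ↦ Hf t' y) t =
          -((ofRiemannian h).inducedMetric (F t) hpb (Hc.isSpacelikeImmersion t ht)).dalembertian
              (fun z ↦ ((ofRiemannian h).meanCurvature (F t) hpb (Hc.isSpacelikeImmersion t ht)
                (ν t) z)⁻¹) y -
            (((ofRiemannian h).inducedMetric (F t) hpb (Hc.isSpacelikeImmersion t ht)).normSq y
                ((ofRiemannian h).secondFundamentalForm (𝓡 2) (F t) (ν t) y) +
              (ofRiemannian h).ricci (F t y) (ν t y) (ν t y)) /
            (ofRiemannian h).meanCurvature (F t) hpb (Hc.isSpacelikeImmersion t ht) (ν t) y) ∧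
        -- Gauss–Bonnet with `χ ≤ 2`
        (∀ t (ht : t ∈ Set.Ioo a b),
          haveI := ((ofRiemannian h).inducedMetric (F t) hpb
            (Hc.isSpacelikeImmersion t ht)).hasLeviCivita
          ∫ y, ((ofRiemannian h).inducedMetric (F t) hpb
            (Hc.isSpacelikeImmersion t ht)).scalarCurvature y
          ∂(riemannianVolume ((ofRiemannian h).inducedRiemannianMetric (F t) hpb
            (Hc.isSpacelikeImmersion t ht)) 2) ≤ 8 * π)) :
    geroch_monotonicity_smooth := by
  refine geroch_monotonicity_smooth_of_F13 ?_
  intro X _ _ _ _ _ h _ S _ _ _ _ _ _ _ _ hpb F ν a b Hc hR t ht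
  obtain ⟨Hf, hHf, hreg, hevol, hGB⟩ := hin X h S hpb F ν a b Hc hR
  exact ⟨fun y ↦ deriv (fun t' ↦ Hf t' y) t,
    Hc.hasDerivAt_sqMeanCurvatureIntegral Hf hHf hreg ht, hevol t ht, hGB t ht⟩

end Literature.Geometry.Lorentzian

end
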